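/-
Copyright (c) 2026. All rights reserved.
Released under Apache 2.0 license as described in the file LICENSE.
Authors: HodgeCM publication cell (pub-hodgecm), GR lane, seat GR-2 (`pub-hodgecm-own-hyp34`).
-/
import Literature.NumberTheory.Weil1964.ArchUnitaryWeilHalfGen
import Literature.NumberTheory.Weil1964.ArchUnitaryWeilHalfSub
import Literature.NumberTheory.Weil1964.ArchRealSplitPlacesSection
import Literature.NumberTheory.Weil1964.ArchFrameDictionaryRealSplit
import HarnessLib

/-!
# The archimedean Weil section of ONE adelic unitary group over a GENERAL quadratic extension `E/F`:
# three blocks (inert real places ⊠ split real places) ⊠ complex places, and its frame dictionary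

Topic `NumberTheory/Weil1964`; namespace `Literature.NumberTheory.Weil1964` (continues `ArchUnitaryWeilHalfGen`).
KERNEL ONLY: definitions with bodies and theorems; no `def … : Prop` record, no axiom, no proof hole.

`ArchUnitaryWeilHalfGen` treats a general base field `F` but needs a `c`-fixed COMPLEX place of `E` over every real
place of `F` (automatic for `E` totally complex).  Here `E/F` is an arbitrary quadratic extension of number fields:
the real places of `F` are split by a predicate `p` into type (i) (`p v`: a chosen `c`-fixed complex place `w₁(v)` of
`E` over `v`, `E_v = ℂ`) and type (ii) (`¬ p v`: a chosen REAL place `w₂(v)` of `E` over `v`, `E_v = ℝ × ℝ`); over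
each complex place `v` a place `w(v)` is chosen.  `J = diag(t₀) ⊗ 1`, all `t₀ j ≠ 0`.

* §1 the relabelling `realBlockIdx : Fin N × {v real} ≃ (Fin N × {v // p v}) ⊕ (Fin N × {v // ¬ p v})`, the frame
  scalings `scale3` (`√|σ_v t₀ / im σ_{w₁(v)} δ|` at type (i), `1` at type (ii)) and the frame
  `frame3 := scaledFrameGenT (cxTwist w) (placeScale scale3) 1` of `W_∞`;
* §2 **`archWeilSection3 x₂ x₃ : U(J)(F ⊗ ℝ) →* Mp^𝓢(ℝ^{FrameIdx})`** :=
  `reindex (archWeilSectionSub ⊠ rsPlacesSection x₂) ⊠ cxPlacesSection x₃` — Folland's `det^{1/2}`-normalised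
  `U(p,q)` section on the type-(i) block (`ArchUnitaryWeilHalfSub`), the conjugated Levi sections on the type-(ii)
  block (`ArchRealSplitPlacesSection`, lift `x₂` of the framed split Cayley elements `rsCayley`) and on the complex
  block (`ArchComplexPlacesSection`, lift `x₃`); strongly continuous (`continuous_archWeilSection3_apply`);
* §3 **THE DICTIONARY `archPhaseMap (T ⊗ 1) frame3 (ι_𝔸(g, 1)) = ⇑(proj (archWeilSection3 x₂ x₃ g))`**
  (`archPhaseMap_eq_coe_proj_archWeilSection3`), slice by slice: type (i) by
  `ArchFrameDictionaryRealAt.realSlice_archPhaseMap_adelicToSymplectic_at`, type (ii) by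
  `ArchFrameDictionaryRealSplit.realSlice_archPhaseMap_archToAdelic_realSplit` + `ArchRealSplitFrameConj.rsRealify_toSymplectic`,
  complex by `ArchFrameDictionaryGen.cxSlice_archPhaseMap_archToAdelic`;
* §4 **`quot_archWeilSection3`**: `quot = ∏_{type (i)} (det g_{w₁(v)})⁻¹ · ∏_{type (ii)} sgn det g_{w₂(v)}`.

The `archLift` of §2–§3 (the archimedean half `s_∞ : U(J)(F ⊗ ℝ) →* Mp_ψ(W_𝔸)ᶜᵒⁿᵗ` for every quadratic `E/F`)
is the sequel.  Written for the stage-1 cell `pub-hodgecm` (GR lane); nothing here is a claim of the manuscripts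
adjudicated by that cell.

## References
* [GelbartRogawski1991] S. Gelbart, J. Rogawski, Invent. math. 105 (1991), §3.1 p. 454, Prop. 3.1.1.
* [Weil1964] A. Weil, Acta Math. 111 (1964), Chap. I n° 12, Chap. III n° 37–39 pp. 188–190.
* [MoeglinVignerasWaldspurger1987] C. Mœglin, M.-F. Vignéras, J.-L. Waldspurger, LNM 1291 (1987), Chap. 1 I.17–I.19,
  Chap. 2 II.1–II.2, III.1.
* [Folland1989] G. B. Folland, *Harmonic Analysis in Phase Space*, Princeton UP 1989, §1.7, §4.2 (4.24), (4.37), Prop. (4.39).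
* [KonnoKonno2007] K. Konno, T. Konno, Kyushu J. Math. 61 (2007), §3.1 (3.1).
* [Kudla1994] S. S. Kudla, Israel J. Math. 87 (1994), §3.
-/

set_option autoImplicit false

noncomputable section

open scoped Matrix Real Classical ComplexConjugate
open Complex NumberField NumberField.InfinitePlace NumberField.mixedEmbedding IsDedekindDomain
open Literature.NumberTheory.Automorphic Literature.NumberTheory.Automorphic.UnitaryGroup
open Literature.RepresentationTheory.HeisenbergGroup Literature.Analysis.SegalBargmann
open Literature.RepresentationTheory.HeisenbergGroup.SymplecticMatrix
open Literature.RepresentationTheory.KonnoKonno2007 Literature.RepresentationTheory.KonnoKonno2007.RealDualPair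

namespace Literature.NumberTheory.Weil1964

open MpS UnitaryWeil

local notation "PV" σ => (σ → ℝ) × (σ → ℝ)
local notation "SpR" σ => symplecticGroup (polar (dotPairing σ))

/-! ## §0 A generic tool -/

section Tools

/-- **strong continuity of `g ↦ S₁ g ⊠ S₂ g`** for two strongly continuous families in `Mp^𝓢` over a locally compact
group (Banach–Steinhaus, `SegalBargmann.continuous_tensorOp_apply`). [cite: Folland1989, §1.7; Weil1964, Chap. III n° 39] -/
theorem MpS.continuous_tensor_snd_apply {G : Type*} [TopologicalSpace G] [LocallyCompactSpace G]
    {σ₁ σ₂ : Type*} [Fintype σ₁] [DecidableEq σ₁] [Fintype σ₂] [DecidableEq σ₂] (S₁ : G → MpS σ₁) (S₂ : G → MpS σ₂)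
    (h₁ : ∀ f : SchwartzMap (σ₁ → ℝ) ℂ, Continuous fun g => (S₁ g).1.2 f)
    (h₂ : ∀ f : SchwartzMap (σ₂ → ℝ) ℂ, Continuous fun g => (S₂ g).1.2 f) (f : SchwartzMap (σ₁ ⊕ σ₂ → ℝ) ℂ) :
    Continuous fun g => (MpS.tensor (S₁ g) (S₂ g)).1.2 f := by
  have h := continuous_tensorOp_apply
    (fun g => ((S₁ g).1.2 : SchwartzMap (σ₁ → ℝ) ℂ →L[ℂ] SchwartzMap (σ₁ → ℝ) ℂ))
    (fun g => ((S₂ g).1.2 : SchwartzMap (σ₂ → ℝ) ℂ →L[ℂ] SchwartzMap (σ₂ → ℝ) ℂ)) h₁ h₂ f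
  have h' : (fun g => (MpS.tensor (S₁ g) (S₂ g)).1.2 f) =
      (fun gg : G × G => tensorOp ((S₁ gg.1).1.2 : SchwartzMap (σ₁ → ℝ) ℂ →L[ℂ] SchwartzMap (σ₁ → ℝ) ℂ)
        ((S₂ gg.2).1.2 : SchwartzMap (σ₂ → ℝ) ℂ →L[ℂ] SchwartzMap (σ₂ → ℝ) ℂ) f) ∘ fun g => (g, g) := by
    funext g
    exact MpS.tensor_apply _ _ f
  rw [h']
  exact h.comp (continuous_id.prodMk continuous_id)

end Tools

section Three

variable {F : Type} [Field F] [NumberField F] (E : Type) [Field E] [NumberField E] [Algebra F E]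
  [Algebra.IsQuadraticExtension F E] (c : E ≃ₐ[F] E) (N : ℕ) (hc : c ≠ 1) (hcc : c * c = 1)
  (p : {v : InfinitePlace F // v.IsReal} → Prop)
  (wOf₁ : {v : {v : InfinitePlace F // v.IsReal} // p v} → {w : InfinitePlace E // w.IsComplex})
  (hw₁ : ∀ k, c • (wOf₁ k).1 = (wOf₁ k).1) (hover₁ : ∀ k, (wOf₁ k).1.comap (algebraMap F E) = k.1.1)
  (wOf₂ : {v : {v : InfinitePlace F // v.IsReal} // ¬ p v} → {w : InfinitePlace E // w.IsReal})
  (hover₂ : ∀ k, (wOf₂ k).1.comap (algebraMap F E) = k.1.1)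
  (wOf : {v : InfinitePlace F // v.IsComplex} → {w : InfinitePlace E // w.IsComplex})
  (hover : ∀ v, (wOf v).1.comap (algebraMap F E) = v.1)
  (t₀ : Fin N → F) (ht0 : ∀ j, t₀ j ≠ 0) {T : Matrix (Fin N) (Fin N) F} (hTd : T = Matrix.diagonal t₀)
  {J : Matrix (Fin N) (Fin N) E} (hJ : J = T.map (algebraMap F E)) {δ : E} (hcδ : c δ = -δ) (hδ : δ ≠ 0)
  {d : F} (hd : δ * δ = algebraMap F E d)

/-! ## §1 The relabelling of the real block, the frame scalings and the frame -/

/-- **the relabelling of the real coordinates by place type**: `(j, v) ↦ inl (j, v)` if `p v`, `inr (j, v)` otherwise.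
[cite: Weil1964, Chap. III n° 37] -/
def realBlockIdx : Fin N × {v : InfinitePlace F // v.IsReal} ≃
    (Fin N × {v : {v : InfinitePlace F // v.IsReal} // p v}) ⊕ (Fin N × {v : {v : InfinitePlace F // v.IsReal} // ¬ p v}) where
  toFun k := if h : p k.2 then Sum.inl (k.1, ⟨k.2, h⟩) else Sum.inr (k.1, ⟨k.2, h⟩)
  invFun := Sum.elim (fun k => (k.1, k.2.1)) (fun k => (k.1, k.2.1))
  left_inv k := by
    by_cases h : p k.2
    · simp only [dif_pos h, Sum.elim_inl]
    · simp only [dif_neg h, Sum.elim_inr]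
  right_inv k := by
    rcases k with ⟨j, v, h⟩ | ⟨j, v, h⟩
    · simp only [Sum.elim_inl, dif_pos h]
    · simp only [Sum.elim_inr, dif_neg h]

omit [NumberField F] in
/-- at a type-(i) place: `realBlockIdx (j, v) = inl (j, v)`. [cite: Weil1964, Chap. III n° 37] -/
theorem realBlockIdx_apply_of_pos (j : Fin N) {v : {v : InfinitePlace F // v.IsReal}} (h : p v) :
    realBlockIdx N p (j, v) = Sum.inl (j, ⟨v, h⟩) := dif_pos h

omit [NumberField F] in
/-- at a type-(ii) place: `realBlockIdx (j, v) = inr (j, v)`. [cite: Weil1964, Chap. III n° 37] -/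
theorem realBlockIdx_apply_of_neg (j : Fin N) {v : {v : InfinitePlace F // v.IsReal}} (h : ¬ p v) :
    realBlockIdx N p (j, v) = Sum.inr (j, ⟨v, h⟩) := dif_neg h

omit [NumberField F] in
/-- the relabelled block-sum phase map at a type-(i) real coordinate, first component. [cite: Weil1964, Chap. I n° 12] -/
theorem reindexPhase_realBlockIdx_fst_of_pos (Ψ₁ : PhaseMap (Fin N × {v : {v : InfinitePlace F // v.IsReal} // p v}))
    (Ψ₂ : PhaseMap (Fin N × {v : {v : InfinitePlace F // v.IsReal} // ¬ p v}))
    (PQ : PV (Fin N × {v : InfinitePlace F // v.IsReal})) (j : Fin N) {v : {v : InfinitePlace F // v.IsReal}} (h : p v) :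
    (reindexPhase (realBlockIdx N p) (blockPhase Ψ₁ Ψ₂) PQ).1 (j, v) =
      (Ψ₁ (fun k => PQ.1 (k.1, k.2.1), fun k => PQ.2 (k.1, k.2.1))).1 (j, ⟨v, h⟩) := by
  show ((blockPhase Ψ₁ Ψ₂) (PQ.1 ∘ (realBlockIdx N p).symm, PQ.2 ∘ (realBlockIdx N p).symm)).1 (realBlockIdx N p (j, v)) = _
  rw [realBlockIdx_apply_of_pos N p j h]
  rfl

omit [NumberField F] in
/-- the relabelled block-sum phase map at a type-(i) real coordinate, second component. [cite: Weil1964, Chap. I n° 12] -/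
theorem reindexPhase_realBlockIdx_snd_of_pos (Ψ₁ : PhaseMap (Fin N × {v : {v : InfinitePlace F // v.IsReal} // p v}))
    (Ψ₂ : PhaseMap (Fin N × {v : {v : InfinitePlace F // v.IsReal} // ¬ p v}))
    (PQ : PV (Fin N × {v : InfinitePlace F // v.IsReal})) (j : Fin N) {v : {v : InfinitePlace F // v.IsReal}} (h : p v) :
    (reindexPhase (realBlockIdx N p) (blockPhase Ψ₁ Ψ₂) PQ).2 (j, v) =
      (Ψ₁ (fun k => PQ.1 (k.1, k.2.1), fun k => PQ.2 (k.1, k.2.1))).2 (j, ⟨v, h⟩) := by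
  show ((blockPhase Ψ₁ Ψ₂) (PQ.1 ∘ (realBlockIdx N p).symm, PQ.2 ∘ (realBlockIdx N p).symm)).2 (realBlockIdx N p (j, v)) = _
  rw [realBlockIdx_apply_of_pos N p j h]
  rfl

omit [NumberField F] in
/-- the relabelled block-sum phase map at a type-(ii) real coordinate, first component. [cite: Weil1964, Chap. I n° 12] -/
theorem reindexPhase_realBlockIdx_fst_of_neg (Ψ₁ : PhaseMap (Fin N × {v : {v : InfinitePlace F // v.IsReal} // p v}))
    (Ψ₂ : PhaseMap (Fin N × {v : {v : InfinitePlace F // v.IsReal} // ¬ p v}))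
    (PQ : PV (Fin N × {v : InfinitePlace F // v.IsReal})) (j : Fin N) {v : {v : InfinitePlace F // v.IsReal}} (h : ¬ p v) :
    (reindexPhase (realBlockIdx N p) (blockPhase Ψ₁ Ψ₂) PQ).1 (j, v) =
      (Ψ₂ (fun k => PQ.1 (k.1, k.2.1), fun k => PQ.2 (k.1, k.2.1))).1 (j, ⟨v, h⟩) := by
  show ((blockPhase Ψ₁ Ψ₂) (PQ.1 ∘ (realBlockIdx N p).symm, PQ.2 ∘ (realBlockIdx N p).symm)).1 (realBlockIdx N p (j, v)) = _
  rw [realBlockIdx_apply_of_neg N p j h]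
  rfl

omit [NumberField F] in
/-- the relabelled block-sum phase map at a type-(ii) real coordinate, second component. [cite: Weil1964, Chap. I n° 12] -/
theorem reindexPhase_realBlockIdx_snd_of_neg (Ψ₁ : PhaseMap (Fin N × {v : {v : InfinitePlace F // v.IsReal} // p v}))
    (Ψ₂ : PhaseMap (Fin N × {v : {v : InfinitePlace F // v.IsReal} // ¬ p v}))
    (PQ : PV (Fin N × {v : InfinitePlace F // v.IsReal})) (j : Fin N) {v : {v : InfinitePlace F // v.IsReal}} (h : ¬ p v) :
    (reindexPhase (realBlockIdx N p) (blockPhase Ψ₁ Ψ₂) PQ).2 (j, v) =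
      (Ψ₂ (fun k => PQ.1 (k.1, k.2.1), fun k => PQ.2 (k.1, k.2.1))).2 (j, ⟨v, h⟩) := by
  show ((blockPhase Ψ₁ Ψ₂) (PQ.1 ∘ (realBlockIdx N p).symm, PQ.2 ∘ (realBlockIdx N p).symm)).2 (realBlockIdx N p (j, v)) = _
  rw [realBlockIdx_apply_of_neg N p j h]
  rfl

/-- **the frame scalings**: `√|σ_v t₀ / im σ_{w₁(v)} δ|` at a type-(i) place, `1` at a type-(ii) place.
[cite: Folland1989, §1.3 (1.25); KonnoKonno2007, §3.1] -/
def scale3 (v : {v : InfinitePlace F // v.IsReal}) : Fin N → ℝ :=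
  if h : p v then sqrtAbs (signVecAt v (wOf₁ ⟨v, h⟩) t₀ δ) else fun _ => 1

omit [NumberField F] [NumberField E] [Algebra F E] in
/-- at a type-(i) place. [cite: Folland1989, §1.3 (1.25)] -/
theorem scale3_of_pos {v : {v : InfinitePlace F // v.IsReal}} (h : p v) :
    scale3 E N p wOf₁ t₀ (δ := δ) v = sqrtAbs (signVecAt v (wOf₁ ⟨v, h⟩) t₀ δ) := dif_pos h

omit [NumberField F] [NumberField E] [Algebra F E] in
/-- at a type-(ii) place. [cite: Folland1989, §1.3 (1.25)] -/
theorem scale3_of_neg {v : {v : InfinitePlace F // v.IsReal}} (h : ¬ p v) (j : Fin N) :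
    scale3 E N p wOf₁ t₀ (δ := δ) v j = 1 := by
  rw [scale3, dif_neg h]

omit [NumberField F] [NumberField E] [Algebra.IsQuadraticExtension F E] in
include hc hw₁ hcδ hδ ht0 in
/-- the scalings do not vanish. [cite: Folland1989, §1.3 (1.25)] -/
theorem scale3_ne_zero : ∀ v j, scale3 E N p wOf₁ t₀ (δ := δ) v j ≠ 0 := fun v j => by
  by_cases h : p v
  · rw [scale3_of_pos E N p wOf₁ t₀ h]; exact sqrtAbs_signVecAt_ne_zero hc (hw₁ ⟨v, h⟩) hcδ hδ ht0 j
  · rw [scale3_of_neg E N p wOf₁ t₀ h j]; exact one_ne_zero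

/-- **the Folland frame of `W_∞` for a general quadratic `E/F`**: scalings `scale3` at the real places, `1` and the
coordinate twists `placeTwist v w(v)` at the complex places. [cite: Folland1989, §1.3 (1.25); KonnoKonno2007, §3.1] -/
def frame3 : (Fin N → mixedSpace F) ≃L[ℝ] (FrameIdx F (Fin N) → ℝ) :=
  scaledFrameGenT F (Fin N) (cxTwist F E wOf hover) (continuous_cxTwist F E wOf hover)
    (placeScale N (scale3 E N p wOf₁ t₀ (δ := δ))) (placeScale_ne_zero N (scale3_ne_zero E c N hc p wOf₁ hw₁ t₀ ht0 hcδ hδ))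
    (fun _ => (1 : ℂ)) (fun _ => one_ne_zero)

/-- **the framed split Cayley elements** `κ_v = rsCayley (σ_v t₀)` at the type-(ii) places (`ArchRealSplitFrameConj`).
[cite: MoeglinVignerasWaldspurger1987, Chap. 2 III.1] -/
def rsCayley3 (k : {v : {v : InfinitePlace F // v.IsReal} // ¬ p v}) : SpR (Fin N) :=
  rsCayley (fun j => embedding_of_isReal k.1.2 (t₀ j)) (embedding_t₀_ne_zero F N t₀ ht0 k.1)
    (embedding_of_isReal_ne_zero E (wOf₂ k) hδ)

/-! ## §2 The three-block section -/

/-- **`archWeilSection3 x₂ x₃ : U(J)(F ⊗ ℝ) →* Mp^𝓢(ℝ^{FrameIdx})`** :=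
`reindex (archWeilSectionSub ⊠ rsPlacesSection x₂) ⊠ cxPlacesSection x₃`.
[cite: GelbartRogawski1991, §3.1 p. 454; MoeglinVignerasWaldspurger1987, Chap. 2 II.1; Kudla1994, §3] -/
def archWeilSection3 (x₂ : MpS (Fin N × {v : {v : InfinitePlace F // v.IsReal} // ¬ p v}))
    (x₃ : MpS ((Fin N ⊕ Fin N) × {v : InfinitePlace F // v.IsComplex})) :
    UnitaryGroup.arch F E c N J →* MpS (FrameIdx F (Fin N)) :=
  MpS.tensorHom.comp
    (((MpS.reindex (realBlockIdx N p)).comp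
      (MpS.tensorHom.comp
        ((archWeilSectionSub E c N hc (fun k => k.1) wOf₁ hw₁ hover₁ t₀ ht0 hTd hJ hcδ hδ).prod
          (rsPlacesSection F E c hcc N T hJ hδ wOf₂ x₂)))).prod
      (cxPlacesSection F E c hcc N T hJ hδ wOf x₃))

omit [Algebra.IsQuadraticExtension F E] in
/-- unfolding: `archWeilSection3 x₂ x₃ g = reindex (S₁ g ⊠ S₂ g) ⊠ S₃ g`. [cite: MoeglinVignerasWaldspurger1987, Chap. 2 II.1] -/
theorem archWeilSection3_apply (x₂ : MpS (Fin N × {v : {v : InfinitePlace F // v.IsReal} // ¬ p v}))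
    (x₃ : MpS ((Fin N ⊕ Fin N) × {v : InfinitePlace F // v.IsComplex})) (g : UnitaryGroup.arch F E c N J) :
    archWeilSection3 E c N hc hcc p wOf₁ hw₁ hover₁ wOf₂ wOf t₀ ht0 hTd hJ hcδ hδ x₂ x₃ g =
      MpS.tensor (MpS.reindex (realBlockIdx N p)
        (MpS.tensor (archWeilSectionSub E c N hc (fun k => k.1) wOf₁ hw₁ hover₁ t₀ ht0 hTd hJ hcδ hδ g)
          (rsPlacesSection F E c hcc N T hJ hδ wOf₂ x₂ g)))
        (cxPlacesSection F E c hcc N T hJ hδ wOf x₃ g) := rfl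

omit [Algebra.IsQuadraticExtension F E] in
/-- **strong continuity of the three-block section** (`U(J)(F ⊗ ℝ)` is locally compact; Banach–Steinhaus twice).
[cite: Folland1989, §1.7; Weil1964, Chap. III n° 39 p. 189] -/
theorem continuous_archWeilSection3_apply (x₂ : MpS (Fin N × {v : {v : InfinitePlace F // v.IsReal} // ¬ p v}))
    (x₃ : MpS ((Fin N ⊕ Fin N) × {v : InfinitePlace F // v.IsComplex})) (f : SchwartzMap (FrameIdx F (Fin N) → ℝ) ℂ) :
    Continuous fun g : UnitaryGroup.arch F E c N J =>
      (archWeilSection3 E c N hc hcc p wOf₁ hw₁ hover₁ wOf₂ wOf t₀ ht0 hTd hJ hcδ hδ x₂ x₃ g).1.2 f := by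
  have h₁ := continuous_archWeilSectionSub_apply E c N hc (fun k => k.1) wOf₁ hw₁ hover₁ t₀ ht0 hTd hJ hcδ hδ
  have h₂ := continuous_rsPlacesSection_snd_apply F E c hcc N T hJ hδ wOf₂ x₂
  have h₃ := continuous_cxPlacesSection_snd_apply F E c hcc N T hJ hδ wOf x₃
  have h12 := MpS.continuous_tensor_snd_apply (G := UnitaryGroup.arch F E c N J) _ _ h₁ h₂
  have hR : ∀ f', Continuous fun g : UnitaryGroup.arch F E c N J =>
      (MpS.reindex (realBlockIdx N p)
        (MpS.tensor (archWeilSectionSub E c N hc (fun k => k.1) wOf₁ hw₁ hover₁ t₀ ht0 hTd hJ hcδ hδ g)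
          (rsPlacesSection F E c hcc N T hJ hδ wOf₂ x₂ g))).1.2 f' := fun f' => by
    simp only [MpS.reindex_apply]
    exact (schwartzTransport _).continuous.comp (h12 _)
  have h := MpS.continuous_tensor_snd_apply (G := UnitaryGroup.arch F E c N J) _ _ hR h₃ f
  exact h

/-! ## §3 The dictionary -/

include hd hover₂ in
/-- **THE DICTIONARY, general quadratic `E/F`**: in the frame `frame3` the archimedean phase map of `ι_𝔸(g, 1)` IS the
phase action of `archWeilSection3 x₂ x₃ g` (for lifts `x₂` of the framed split Cayley elements and `x₃` of the realified
complex Cayley elements), slice by slice: type-(i) real slices = Konno–Konno's `U(P_v, Q_v) ↪ Sp` of the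
`w₁(v)`-components; type-(ii) real slices = the framed conjugated Levi `κ_v⁻¹ m(g_{w₂(v)}) κ_v`; complex slices = the
realified conjugated Levi of the `w(v)`-components. [cite: GelbartRogawski1991, §3.1 p. 454; KonnoKonno2007, §3.1 (3.1);
MoeglinVignerasWaldspurger1987, Chap. 1 I.17, Chap. 2 III.1; Folland1989, Ch. 4 §1, Prop. (4.6), §4.2 (4.24)] -/
theorem archPhaseMap_eq_coe_proj_archWeilSection3 (x₂ : MpS (Fin N × {v : {v : InfinitePlace F // v.IsReal} // ¬ p v}))
    (hx₂ : MpS.proj x₂ = placeSp fun k => (rsCayley3 E N p wOf₂ t₀ ht0 hδ k)⁻¹)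
    (x₃ : MpS ((Fin N ⊕ Fin N) × {v : InfinitePlace F // v.IsComplex}))
    (hx₃ : MpS.proj x₃ = placeSp fun v => (cxKappaFamily F E N T (isSymm_of_diagonal N t₀ hTd)
      (isUnit_det_of_diagonal N t₀ ht0 hTd) hδ wOf v)⁻¹)
    (hTu : IsUnit (archMat F (Fin N) (T.map (algebraMap F (AdeleRing (𝓞 F) F))))) (g : UnitaryGroup.arch F E c N J) :
    archPhaseMap (T.map (algebraMap F (AdeleRing (𝓞 F) F)))
        (frame3 E c N hc p wOf₁ hw₁ wOf hover t₀ ht0 hcδ hδ) hTu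
        (((adelicToSymplectic F E c N hcδ hδ hd (isSymm_of_diagonal N t₀ hTd) hJ).comp (UnitaryGroup.archToAdelic F E c N J)) g) =
      ⇑(((MpS.proj (archWeilSection3 E c N hc hcc p wOf₁ hw₁ hover₁ wOf₂ wOf t₀ ht0 hTd hJ hcδ hδ x₂ x₃ g)).1 :
        (PV (FrameIdx F (Fin N))) ≃ₗ[ℝ] PV (FrameIdx F (Fin N)))) := by
  have hS₁ := coe_proj_archWeilSectionSub E c N hc (fun k => k.1) wOf₁ hw₁ hover₁ t₀ ht0 hTd hJ hcδ hδ g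
  have hS₂ := coe_proj_placeLeviSection (rsLeviFamily F E c hcc N T hJ hδ wOf₂) _ x₂ hx₂ g
  have hS₃ := coe_proj_cxPlacesSection F E c hcc N T (isSymm_of_diagonal N t₀ hTd) (isUnit_det_of_diagonal N t₀ ht0 hTd)
    hJ hδ wOf x₃ hx₃ g
  conv_rhs => simp only [archWeilSection3_apply, MpS.proj_tensor, coe_spBlock_apply, MpS.proj_reindex, coe_reindexSp,
    hS₁, rsPlacesSection, hS₂, hS₃]
  subst hTd
  funext pq
  refine Prod.ext (funext fun k => ?_) (funext fun k => ?_)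
  · rcases k with ⟨j, v⟩ | ⟨i, v⟩
    · by_cases h : p v
      · -- type (i) real place
        have key := realSlice_archPhaseMap_adelicToSymplectic_at E c N hc v (wOf₁ ⟨v, h⟩) (hw₁ ⟨v, h⟩) (hover₁ ⟨v, h⟩) t₀ hJ
          (signSplit (signVecAt v (wOf₁ ⟨v, h⟩) t₀ δ)) (D := scale3 E N p wOf₁ t₀ (δ := δ))
          (scale3_ne_zero E c N hc p wOf₁ hw₁ t₀ ht0 hcδ hδ) (c' := deltaImAt (wOf₁ ⟨v, h⟩) δ)
          (deltaImAt_ne_zero hc (hw₁ ⟨v, h⟩) hcδ hδ)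
          (fun j => by rw [scale3_of_pos E N p wOf₁ t₀ h]; exact ht_signVecAt hc (hw₁ ⟨v, h⟩) hcδ hδ ht0 j)
          (cxTwist F E wOf hover) (continuous_cxTwist F E wOf hover) (fun _ => (1 : ℂ)) (fun _ => one_ne_zero) hcδ hδ hd
          (Matrix.isSymm_diagonal t₀) rfl hTu (UnitaryGroup.archToAdelic F E c N J g) pq
        have h1 := congrArg (fun PQ : PV (Fin N) => PQ.1 j) key
        simp only [realSlice_apply] at h1
        rw [MonoidHom.comp_apply]
        refine h1.trans ?_
        rw [UForm.coe_toSp, archUFormAt_congr E c N hc v (wOf₁ ⟨v, h⟩) (hw₁ ⟨v, h⟩) (hover₁ ⟨v, h⟩) t₀ hJ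
          (signSplit (signVecAt v (wOf₁ ⟨v, h⟩) t₀ δ)) (scale3_of_pos E N p wOf₁ t₀ h) (scale3_ne_zero E c N hc p wOf₁ hw₁ t₀ ht0 hcδ hδ v)
          (sqrtAbs_signVecAt_ne_zero hc (hw₁ ⟨v, h⟩) hcδ hδ ht0) (deltaImAt_ne_zero hc (hw₁ ⟨v, h⟩) hcδ hδ) _
          (ht_signVecAt hc (hw₁ ⟨v, h⟩) hcδ hδ ht0)]
        symm
        exact reindexPhase_realBlockIdx_fst_of_pos N p _ _ _ j h
      · -- type (ii) real place
        have key := realSlice_archPhaseMap_archToAdelic_realSplit F E c hcc N hcδ hδ hd t₀ ht0 hJ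
          (scale3 E N p wOf₁ t₀ (δ := δ)) (scale3_ne_zero E c N hc p wOf₁ hw₁ t₀ ht0 hcδ hδ)
          (cxTwist F E wOf hover) (continuous_cxTwist F E wOf hover) (fun _ => (1 : ℂ)) (fun _ => one_ne_zero)
          v (wOf₂ ⟨v, h⟩) (hover₂ ⟨v, h⟩) (Matrix.isSymm_diagonal t₀) hTu (fun j => scale3_of_neg E N p wOf₁ t₀ h j) g pq
        rw [rsRealify_toSymplectic] at key
        have h1 := congrArg (fun PQ : PV (Fin N) => PQ.1 j) key
        simp only [realSlice_apply] at h1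
        rw [MonoidHom.comp_apply]
        refine h1.trans ?_
        symm
        refine (reindexPhase_realBlockIdx_fst_of_neg N p _ _ _ j h).trans ?_
        rw [placePhase_fst, rsLeviFamily_apply]
        rfl
    · -- complex place
      have key := cxSlice_archPhaseMap_archToAdelic F E c hcc N hcδ hδ hd (Matrix.diagonal t₀) (Matrix.isSymm_diagonal t₀)
        (isUnit_det_of_diagonal N t₀ ht0 rfl) hJ wOf hover (placeScale N (scale3 E N p wOf₁ t₀ (δ := δ)))
        (placeScale_ne_zero N (scale3_ne_zero E c N hc p wOf₁ hw₁ t₀ ht0 hcδ hδ)) hTu v g pq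
      have h1 := congrArg (fun PQ : PV (Fin N ⊕ Fin N) => PQ.1 i) key
      simp only [cxSlice_apply] at h1
      rw [MonoidHom.comp_apply]
      exact h1
  · rcases k with ⟨j, v⟩ | ⟨i, v⟩
    · by_cases h : p v
      · -- type (i) real place
        have key := realSlice_archPhaseMap_adelicToSymplectic_at E c N hc v (wOf₁ ⟨v, h⟩) (hw₁ ⟨v, h⟩) (hover₁ ⟨v, h⟩) t₀ hJ
          (signSplit (signVecAt v (wOf₁ ⟨v, h⟩) t₀ δ)) (D := scale3 E N p wOf₁ t₀ (δ := δ))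
          (scale3_ne_zero E c N hc p wOf₁ hw₁ t₀ ht0 hcδ hδ) (c' := deltaImAt (wOf₁ ⟨v, h⟩) δ)
          (deltaImAt_ne_zero hc (hw₁ ⟨v, h⟩) hcδ hδ)
          (fun j => by rw [scale3_of_pos E N p wOf₁ t₀ h]; exact ht_signVecAt hc (hw₁ ⟨v, h⟩) hcδ hδ ht0 j)
          (cxTwist F E wOf hover) (continuous_cxTwist F E wOf hover) (fun _ => (1 : ℂ)) (fun _ => one_ne_zero) hcδ hδ hd
          (Matrix.isSymm_diagonal t₀) rfl hTu (UnitaryGroup.archToAdelic F E c N J g) pq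
        have h1 := congrArg (fun PQ : PV (Fin N) => PQ.2 j) key
        simp only [realSlice_apply] at h1
        rw [MonoidHom.comp_apply]
        refine h1.trans ?_
        rw [UForm.coe_toSp, archUFormAt_congr E c N hc v (wOf₁ ⟨v, h⟩) (hw₁ ⟨v, h⟩) (hover₁ ⟨v, h⟩) t₀ hJ
          (signSplit (signVecAt v (wOf₁ ⟨v, h⟩) t₀ δ)) (scale3_of_pos E N p wOf₁ t₀ h) (scale3_ne_zero E c N hc p wOf₁ hw₁ t₀ ht0 hcδ hδ v)
          (sqrtAbs_signVecAt_ne_zero hc (hw₁ ⟨v, h⟩) hcδ hδ ht0) (deltaImAt_ne_zero hc (hw₁ ⟨v, h⟩) hcδ hδ) _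
          (ht_signVecAt hc (hw₁ ⟨v, h⟩) hcδ hδ ht0)]
        symm
        exact reindexPhase_realBlockIdx_snd_of_pos N p _ _ _ j h
      · -- type (ii) real place
        have key := realSlice_archPhaseMap_archToAdelic_realSplit F E c hcc N hcδ hδ hd t₀ ht0 hJ
          (scale3 E N p wOf₁ t₀ (δ := δ)) (scale3_ne_zero E c N hc p wOf₁ hw₁ t₀ ht0 hcδ hδ)
          (cxTwist F E wOf hover) (continuous_cxTwist F E wOf hover) (fun _ => (1 : ℂ)) (fun _ => one_ne_zero)
          v (wOf₂ ⟨v, h⟩) (hover₂ ⟨v, h⟩) (Matrix.isSymm_diagonal t₀) hTu (fun j => scale3_of_neg E N p wOf₁ t₀ h j) g pq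
        rw [rsRealify_toSymplectic] at key
        have h1 := congrArg (fun PQ : PV (Fin N) => PQ.2 j) key
        simp only [realSlice_apply] at h1
        rw [MonoidHom.comp_apply]
        refine h1.trans ?_
        symm
        refine (reindexPhase_realBlockIdx_snd_of_neg N p _ _ _ j h).trans ?_
        rw [placePhase_snd, rsLeviFamily_apply]
        rfl
    · -- complex place
      have key := cxSlice_archPhaseMap_archToAdelic F E c hcc N hcδ hδ hd (Matrix.diagonal t₀) (Matrix.isSymm_diagonal t₀)
        (isUnit_det_of_diagonal N t₀ ht0 rfl) hJ wOf hover (placeScale N (scale3 E N p wOf₁ t₀ (δ := δ)))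
        (placeScale_ne_zero N (scale3_ne_zero E c N hc p wOf₁ hw₁ t₀ ht0 hcδ hδ)) hTu v g pq
      have h1 := congrArg (fun PQ : PV (Fin N ⊕ Fin N) => PQ.2 i) key
      simp only [cxSlice_apply] at h1
      rw [MonoidHom.comp_apply]
      exact h1

/-! ## §4 The quotient character -/

omit [Algebra.IsQuadraticExtension F E] in
/-- **`quot (archWeilSection3 x₂ x₃ g) = ∏_{type (i)} (det g_{w₁(v)})⁻¹ · ∏_{type (ii)} sgn det g_{w₂(v)}`** (the complex
places contribute `1`). [cite: Folland1989, §4.2 Thm. (4.37); Paul1998, §1.2 (1.2.2); Kudla1994, §3] -/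
theorem quot_archWeilSection3 (x₂ : MpS (Fin N × {v : {v : InfinitePlace F // v.IsReal} // ¬ p v}))
    (x₃ : MpS ((Fin N ⊕ Fin N) × {v : InfinitePlace F // v.IsComplex})) (g : UnitaryGroup.arch F E c N J) :
    MpS.quot (archWeilSection3 E c N hc hcc p wOf₁ hw₁ hover₁ wOf₂ wOf t₀ ht0 hTd hJ hcδ hδ x₂ x₃ g) =
      (∏ k : {v : {v : InfinitePlace F // v.IsReal} // p v},
        ((((archAt F E c N J (wOf₁ k) (hw₁ k) hc g : archLocal E N J (wOf₁ k)) : GL (Fin N) ℂ) :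
          Matrix (Fin N) (Fin N) ℂ).det)⁻¹) *
      ∏ k : {v : {v : InfinitePlace F // v.IsReal} // ¬ p v},
        (if 0 < ((((g : GL (Fin N) (mixedSpace E)) : Matrix (Fin N) (Fin N) (mixedSpace E))).map (evalR E (wOf₂ k))).det
          then (1 : ℂ) else -1) := by
  rw [archWeilSection3_apply, MpS.quot_tensor, quot_cxPlacesSection, mul_one, MpS.quot_reindex, MpS.quot_tensor,
    quot_archWeilSectionSub, quot_rsPlacesSection]

end Three

end Literature.NumberTheory.Weil1964

end
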